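import Literature.Barriers.Parity.SiegelZeroDichotomyNoSiegelZeros
import Literature.Barriers.Parity.HensleyRichards
import Literature.NumberTheory.Sieve.LinearSieveExistence
import HarnessLib
import Summits.Parity.GeneralizedHardyLittlewood.Theorems.UnboundedSiegelZeros

/-!
# Siegel zeros ⇒ the linear-sieve bounds are attained on intervals (Granville 2022)

Statement layer for the «illusory world» column (conditional consequences of Siegel zeros),
topic «sieved intervals / prime gaps / admissible sets». Source: A. Granville, *Sieving intervals
and Siegel zeros*, Acta Arith. 205 (2022) 1–19 [Granville2022]; held copy = arXiv:2010.01211 (tex),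
§1 (Corollary 1, Proposition 1, Corollaries 2–3, Proposition 2 and the displayed consequence after
it), §2 (the meaning of «infinitely many Siegel zeros», display (2.1)).

Setting (§1): `S(x, y, z) = #{n ∈ (x, x + y] : (n, P(z)) = 1}`, `P(z) = ∏_{p ≤ z} p`,
`G(z) = ∏_{p ≤ z} (1 − 1/p)`, and the Jurkat–Richert functions `F, f` of the linear sieve (the
tree's `Literature.NumberTheory.Sieve.LinearSieve.upperFun` / `lowerFun`), so that unconditionally
`(f(u) + o(1)) G(z) y ≤ S(x, y, z) ≲ F(u) G(z) y` for `y = z^u`. Selberg asked whether the extremal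
bounds for INTERVALS might be better than the general ones; Granville: not if there are infinitely
many Siegel zeros. «Infinitely many Siegel zeros» means (§2, (2.1)): for every `κ > 0` there is a
sequence of primitive real `χ_j mod q_j` with real zeros `β_j ≥ 1 − κ/log q_j` — i.e. Siegel zeros
of every quality `1/κ` at arbitrarily large conductors, the tree's
`Literature.Barriers.Parity.UnboundedSiegelZeros` (Tao–Teräväinen's Definition 1.4), which is the
antecedent used below.

* `Granville2022.sievedCount x y z = S(x, y, z)` (`x ∈ ℤ`, `y, z ∈ ℝ`),
  `Granville2022.mertensProduct z = G(z)`;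
* `granville2022_corollary1` — NAMED FACT, Corollary 1 AS PRINTED: under infinitely many Siegel
  zeros, for each fixed `v > 1` there are arbitrarily large `x, X, y, z`, `y = z^v`, with
  `S(x, y, z) = (F(v) + o(1)) G(z) y` and `S(X, y, z) = (f(v) + o(1)) G(z) y`;
* `granville2022_corollary3` — NAMED FACT, Corollary 3 AS PRINTED: under infinitely many Siegel
  zeros there are arbitrarily large `y` and admissible sets `A(y) ⊆ [0, y]` with
  `#A(y) ∼ 2y/log y` (against the belief `∼ y/log y`); PROVED reading on Richards' `ρ*`
  (`Literature.Barriers.Parity.rhoStar`, file `HensleyRichards.lean`):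
  `Granville2022.rhoStar_ge` (`ρ*(y + 1) ≥ (2 − ε) y/log y` for arbitrarily large `y`);
* `granville2022_proposition2_consequence` — NAMED FACT, the consequence displayed after
  Proposition 2 (an EXIT of the illusory world, interval form of Motohashi's theorem): if
  `S(x, y, y^{1/2}) ≤ (2 − η) y/log y` for all integers `x` and all large `y`, then every real zero
  of `L(s, χ)`, `χ` primitive quadratic mod `q`, has `β ≤ 1 − (η² + o(1))/(8 log q)` («that is,
  there are no Siegel zeros»); PROVED from it: `Granville2022.not_unboundedSiegelZeros_of_intervalSieve`
  and **`Granville2022.noSiegelZeros_of_intervalSieve`** (the tree's open `NoSiegelZeros`, via the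
  PROVED `noSiegelZeros_of_not_unboundedSiegelZeros`).

Index only (not typed): Proposition 1 (`S(X, y, z) ≲ (4y/log²y) log⁺(qy/z²) + (1 − β_q) y` for
`y^{1−ε} > z > y^{1/2−o(1)}`, `y = q^{A−1}`); Corollary 2 (Siegel zeros with
`1 − β < (log q)^{−B}` ⇒ `p_{n+1} − p_n ≫ log p_n (log log p_n)^{B−1}` infinitely often — «pretty much
the same lower bounds … were recently given by Ford, by fundamentally the same proof»: typed from
Ford's paper in `SiegelZerosLargePrimeGaps.lean`, where it is DERIVED from Ford's Theorem 1.4); the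
four regimes of Proposition 2; §3's heuristic `limsup G(x)/log²x = ∞`.

LABEL: instrument / statement layer. WHAT THIS IS NOT: no claim that Siegel zeros exist; the tree's
`Literature.Barriers.Parity.LinearSieveOptimality` (Selberg's `𝒜^±`) is the unconditional
optimality for general sequences — this file records that INTERVALS are extremal too, but only in
the illusory world; nothing here bears on the parity problem unconditionally.

## References

* [Granville2022] A. Granville, *Sieving intervals and Siegel zeros*, Acta Arith. 205 (2022),
  no. 1, 1–19, doi:10.4064/aa201002-25-6 = arXiv:2010.01211: §1 Corollary 1, Proposition 1,
  Corollaries 2–3, Proposition 2 and the display after it; §2 (2.1).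
* [TaoTeravainen2021] T. Tao, J. Teräväinen, JLMS 106 (2022), Definition 1.4 (quality;
  `UnboundedSiegelZeros`).
* [Richards1974] I. Richards, Bull. AMS 80 (1974) (`ρ*(x)`, as in `HensleyRichards.lean`).
* [Greaves2001] G. Greaves, *Sieves in Number Theory* (2001), §4.2 (the linear sieve functions
  `F, f`, as in `LinearSieveExistence.lean`).
* [Motohashi1979SiegelZeros] Y. Motohashi, 1979 (the progression form of the exit; tree
  `Literature.Barriers.Parity.BrunTitchmarshSiegelZero`).
-/

noncomputable section

open Finset Real
open Literature.Barriers.Parity Literature.NumberTheory.Sieve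

namespace Literature.NumberTheory.LFunctions

namespace Granville2022

/-- The primes `p ≤ z`. [folklore] -/
def primesLE (z : ℝ) : Finset ℕ := (Finset.Iic ⌊z⌋₊).filter Nat.Prime

/-- **`S(x, y, z) := #{n ∈ (x, x + y] : (n, P(z)) = 1}`**, `P(z) = ∏_{p ≤ z} p` — the integers of
the interval `(x, x + y]` (`x ∈ ℤ`, `y ≥ 0` real) free of prime factors `p ≤ z`.
[cite: Granville2022, §1 (first display)] -/
def sievedCount (x : ℤ) (y z : ℝ) : ℕ :=
  #{n ∈ Finset.Ioc x (x + ⌊y⌋) | ∀ p ∈ primesLE z, ¬ ((p : ℤ) ∣ n)}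

/-- **`G(z) := ∏_{p ≤ z} (1 − 1/p)`** (for the interval problem each `g(p) = 1`).
[cite: Granville2022, §1 (display defining G(z))] -/
def mertensProduct (z : ℝ) : ℝ :=
  ∏ p ∈ primesLE z, (1 - 1 / (p : ℝ))

end Granville2022

/-- **Granville 2022, Corollary 1** (NAMED FACT, AS PRINTED): «Assume that there are infinitely many
Siegel zeros. For each fixed `v > 1`, there exist arbitrarily large `x, X, y, z` with `y = z^v` such
that `S(x, y, z) = (F(v) + o(1)) G(z) y` and `S(X, y, z) = (f(v) + o(1)) G(z) y`», `F, f` the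
Jurkat–Richert functions of the linear sieve (the tree's `LinearSieve.upperFun` / `lowerFun`).
Rendered: under `UnboundedSiegelZeros` (§2 (2.1): zeros `β_j ≥ 1 − κ/log q_j` for every `κ > 0`),
for every `v > 1`, `ε > 0` and `N` there are integers `x, X ≥ N` and a real `z ≥ N` with
`|S(x, z^v, z) − F(v) G(z) z^v| ≤ ε G(z) z^v` and `|S(X, z^v, z) − f(v) G(z) z^v| ≤ ε G(z) z^v`. Not
proved here (Gallagher/Linnik-type prime number theorem with the exceptional zero, §2, and the
Selberg–Iwaniec `𝒜^±` computation, §2 Corollary 5). [cite: Granville2022, §1 Corollary 1; §2 (2.1)] -/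
def granville2022_corollary1 : Prop :=
  Summit.Parity.GeneralizedHardyLittlewood.UnboundedSiegelZeros → ∀ v : ℝ, 1 < v → ∀ ε : ℝ, 0 < ε → ∀ N : ℝ,
    ∃ (x X : ℤ) (z : ℝ), N ≤ x ∧ N ≤ X ∧ N ≤ z ∧
      |(Granville2022.sievedCount x (z ^ v) z : ℝ) -
          LinearSieve.upperFun v * Granville2022.mertensProduct z * z ^ v| ≤
        ε * (Granville2022.mertensProduct z * z ^ v) ∧
      |(Granville2022.sievedCount X (z ^ v) z : ℝ) -
          LinearSieve.lowerFun v * Granville2022.mertensProduct z * z ^ v| ≤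
        ε * (Granville2022.mertensProduct z * z ^ v)

/-- **Granville 2022, Corollary 3** (NAMED FACT, AS PRINTED): «Suppose that there are infinitely
many Siegel zeros. Then there are arbitrarily large `y` for which there are admissible sets `A(y)`
of length `y` with `A(y) ∼ 2y/log y`» (a set of integers in `[0, y]` has length `≤ y`; admissible =
misses a residue class mod every prime, the tree's `IsAdmissibleTuple`; «it is believed that the
largest admissible set of length `y` contains `∼ y/log y` elements … this belief is untrue if there
are Siegel zeros»). Rendered with `UnboundedSiegelZeros` and `∀ ε ∃` for the `∼`. Not proved here.
[cite: Granville2022, §1 Corollary 3; §2 (2.1)] -/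
def granville2022_corollary3 : Prop :=
  Summit.Parity.GeneralizedHardyLittlewood.UnboundedSiegelZeros → ∀ ε : ℝ, 0 < ε → ∀ N : ℕ, ∃ y : ℕ, N ≤ y ∧
    ∃ H : Finset ℤ, IsAdmissibleTuple H ∧ H ⊆ Finset.Icc (0 : ℤ) y ∧
      (2 - ε) * ((y : ℝ) / Real.log y) ≤ (#H : ℝ) ∧ (#H : ℝ) ≤ (2 + ε) * ((y : ℝ) / Real.log y)

/-- **Granville 2022, the consequence displayed after Proposition 2** (NAMED FACT, AS PRINTED — an
exit of the illusory world, the interval form of Motohashi's theorem): «if one can show that for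
all integers `x` and `y` sufficiently large we have `S(x, y, y^{1/2}) ≤ (2 − η) y/log y` then any
real zeros `β` of `L(s, χ)` for a primitive quadratic character `χ (mod q)` satisfy
`β ≤ 1 − (η² + o(1))/(8 log q)`; that is, there are no Siegel zeros.» Rendered: for `η > 0`, the
interval bound for all `x ∈ ℤ` and all real `y ≥ y₀` implies, for every `ε > 0` and all `q ≥ q₀(ε)`,
`β ≤ 1 − (η² − ε)/(8 log q)` for every real zero `β`. Not proved here (first part of Proposition 2:
`S(X, y, y^{1/2}) ≥ (2 − 2√2 δ − o(1)) y/log y` at some `X` when `1 − β ≤ δ²/log q`).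
[cite: Granville2022, §1 Proposition 2 and the display after it] -/
def granville2022_proposition2_consequence : Prop :=
  ∀ η : ℝ, 0 < η →
    (∃ y₀ : ℝ, ∀ (x : ℤ) (y : ℝ), y₀ ≤ y →
      (Granville2022.sievedCount x y (Real.sqrt y) : ℝ) ≤ (2 - η) * (y / Real.log y)) →
    ∀ ε : ℝ, 0 < ε → ∃ q₀ : ℕ, ∀ (q : ℕ) [NeZero q] (χ : DirichletCharacter ℂ q), q₀ ≤ q →
      χ.IsPrimitive → χ.IsQuadratic → ∀ β : ℝ, χ.LFunction β = 0 →
        β ≤ 1 - (η ^ 2 - ε) / (8 * Real.log q)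

namespace Granville2022

/-! ### PROVED readings -/

/-- **Richards' `ρ*` under Siegel zeros** (Corollary 3 read on the tree's
`Literature.Barriers.Parity.rhoStar`): under infinitely many Siegel zeros, for every `ε > 0` there
are arbitrarily large `y` with `ρ*(y + 1) ≥ (2 − ε) y/log y` (an admissible `A(y) ⊆ [0, y]` lies in
the `y + 1` consecutive integers `(−1, y]`). Modulo the named fact `granville2022_corollary3`.
[cite: Granville2022, §1 Corollary 3] [cite: Richards1974, Definition 1.7] -/
theorem rhoStar_ge (h : granville2022_corollary3) (hU : Summit.Parity.GeneralizedHardyLittlewood.UnboundedSiegelZeros) {ε : ℝ}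
    (hε : 0 < ε) (N : ℕ) :
    ∃ y : ℕ, N ≤ y ∧ (2 - ε) * ((y : ℝ) / Real.log y) ≤ (rhoStar (y + 1) : ℝ) := by
  obtain ⟨y, hNy, H, hadm, hsub, hlo, -⟩ := h hU ε hε N
  refine ⟨y, hNy, hlo.trans ?_⟩
  have hsub' : H ⊆ Finset.Ioc (-1 : ℤ) (-1 + ((y + 1 : ℕ) : ℤ)) := by
    intro a ha
    have := Finset.mem_Icc.1 (hsub ha)
    rw [Finset.mem_Ioc]
    push_cast
    omega
  exact_mod_cast le_rhoStar_of_subset_Ioc hadm hsub'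

/-- **The interval Brun–Titchmarsh improvement bounds the quality of Siegel zeros**: if
`S(x, y, √y) ≤ (2 − η) y/log y` for all `x` and all large `y`, then (modulo
`granville2022_proposition2_consequence`, with `ε = η²/2`) every Siegel zero at a large conductor
has quality `≤ 16/η²`; hence `¬ UnboundedSiegelZeros`. [cite: Granville2022, §1, display after Proposition 2]
[cite: TaoTeravainen2021, Definition 1.4] -/
theorem not_unboundedSiegelZeros_of_intervalSieve (h : granville2022_proposition2_consequence)
    {η : ℝ} (hη : 0 < η)
    (hS : ∃ y₀ : ℝ, ∀ (x : ℤ) (y : ℝ), y₀ ≤ y →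
      (sievedCount x y (Real.sqrt y) : ℝ) ≤ (2 - η) * (y / Real.log y)) :
    ¬ Summit.Parity.GeneralizedHardyLittlewood.UnboundedSiegelZeros := by
  intro hU
  have hη2 : 0 < η ^ 2 / 2 := by positivity
  obtain ⟨q₀, hq₀⟩ := h η hη hS (η ^ 2 / 2) hη2
  -- a Siegel zero of quality `> 16/η²` at a conductor `≥ max q₀ 3`
  obtain ⟨q, hqne, χ, ηT, hq, hηT, hSZ⟩ := hU (16 / η ^ 2 + 1) (max q₀ 3)
  haveI := hqne
  obtain ⟨hprim, hquad, h10, hzero⟩ := hSZ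
  have hq3 : (3 : ℝ) ≤ q := by exact_mod_cast le_trans (le_max_right _ _) hq
  have hlog0 : 0 < Real.log q := Real.log_pos (by linarith)
  have hηTpos : 0 < ηT := by linarith
  -- the consequence at `β = 1 − 1/(ηT log q)`
  have hβ := hq₀ q χ (le_trans (le_max_left _ _) hq) hprim hquad (1 - 1 / (ηT * Real.log q)) hzero
  -- so `1/(ηT log q) ≥ (η² − η²/2)/(8 log q) = η²/(16 log q)`, i.e. `ηT ≤ 16/η²`
  have h1 : (η ^ 2 - η ^ 2 / 2) / (8 * Real.log q) ≤ 1 / (ηT * Real.log q) := by linarith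
  have h2 : ηT ≤ 16 / η ^ 2 := by
    rw [div_le_div_iff₀ (by positivity) (by positivity)] at h1
    rw [le_div_iff₀ (by positivity)]
    nlinarith
  linarith

/-- **Exit: an interval Brun–Titchmarsh inequality with constant `2 − η` settles the tree's open
`NoSiegelZeros`** (rh.S34) — modulo the named fact `granville2022_proposition2_consequence`, via the
PROVED `noSiegelZeros_of_not_unboundedSiegelZeros` (no zeros of unbounded quality at large
conductors ⇒ a uniform `c/log q` real-zero-free interval for all real primitive `χ`, `q ≥ 3`).
Companion of the progression form `Literature.Barriers.Parity.noSiegelZeros_of_uniformBrunTitchmarsh`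
(Motohashi). [cite: Granville2022, §1, display after Proposition 2 («that is, there are no Siegel zeros»)] -/
theorem noSiegelZeros_of_intervalSieve (h : granville2022_proposition2_consequence)
    {η : ℝ} (hη : 0 < η)
    (hS : ∃ y₀ : ℝ, ∀ (x : ℤ) (y : ℝ), y₀ ≤ y →
      (sievedCount x y (Real.sqrt y) : ℝ) ≤ (2 - η) * (y / Real.log y)) :
    NoSiegelZeros :=
  noSiegelZeros_of_not_unboundedSiegelZeros (not_unboundedSiegelZeros_of_intervalSieve h hη hS)

end Granville2022

end Literature.NumberTheory.LFunctions

end
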